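import Literature.AlgebraicGeometry.Motives.CrystallineRealization
import Mathlib.FieldTheory.IsAlgClosed.Classification
import Mathlib.FieldTheory.IsAlgClosed.AlgebraicClosure
import Mathlib.Analysis.Complex.Cardinality
import Mathlib.Analysis.Complex.Polynomial.Basic
import Mathlib.RingTheory.Localization.Cardinality
import HarnessLib

/-!
# `K = W(k)[1/p]` embeds into `ℂ` (helper for `AnchorsAtGenericHodgeLocusPoints`, stmt-HodgeConjecture-13944)

Route `PadicSemiregularLift` of `HodgeConjecture`, item P2b (B1/B2) and the carrier
`Crystalline.PadicAnchor.PadicModel` ask for "a ring embedding `ι : K = W(𝔽̄_p)[1/p] → ℂ` along which the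
generic fibre becomes the complex variety". This file proves that such embeddings EXIST: for a countable
field `k` of characteristic `p` (e.g. `𝔽̄_p = AlgebraicClosure (ZMod p)`), the fraction field `K` of the
Witt ring `W(k)` has the cardinality of the continuum (`W(k) ≃ (ℕ → k)` as sets), so its algebraic closure
is an algebraically closed field of characteristic `0` and cardinality `𝔠 = #ℂ`, hence isomorphic to `ℂ`
(Steinitz: uncountable algebraically closed fields of the same characteristic and cardinality are
isomorphic — Mathlib `IsAlgClosed.ringEquiv_of_equiv_of_charZero`), and `K ↪ K̄ ≅ ℂ`.

* `cardinalMk_wittVector` — `#W(k) = #(ℕ → k)`; `cardinalMk_wittVector_eq_continuum` — `= 𝔠` for `k`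
  countable (and nontrivial);
* `cardinalMk_fractionRing_wittVector` — `#K = 𝔠` (`k` a countable field of characteristic `p`);
* `nonempty_ringHom_fractionRing_wittVector_complex` — **`K →+* ℂ` exists**;
  `nonempty_ringHom_fractionRing_wittVector_algebraicClosure_complex` — in particular for `k = 𝔽̄_p`.

References: E. Steinitz, *Algebraische Theorie der Körper* (1910), §24 (isomorphism of algebraically closed
fields of equal characteristic and transcendence degree) [folklore]; J.-P. Serre, *Local Fields*, II §6 [folklore].
-/

-- the summit-side namespace `Summit.HodgeConjecture.HodgeConjecture.…` (summit = sub-problem, D-0017)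
-- repeats a component by design; the linter would flag every declaration.
set_option linter.dupNamespace false

noncomputable section

open Cardinal
open scoped Isocrystal

namespace Summit.HodgeConjecture.HodgeConjecture.Theorems.AnchorsAtGenericHodgeLocusPoints

section Witt

variable (p : ℕ) (k : Type)

/-- `W(k)` has the cardinality of `ℕ → k` (a Witt vector is its sequence of components). [folklore] -/
theorem cardinalMk_wittVector : #(WittVector p k) = #(ℕ → k) :=
  Cardinal.mk_congr
    { toFun := fun x => x.coeff
      invFun := fun f => WittVector.mk p f
      left_inv := fun x => by cases x; rfl
      right_inv := fun f => rfl }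

/-- For a countable nontrivial `k`, `#W(k) = 𝔠`: `2 ≤ #k ≤ ℵ₀` gives `𝔠 = 2^ℵ₀ ≤ #k^ℵ₀ ≤ ℵ₀^ℵ₀ = 𝔠`.
[folklore] -/
theorem cardinalMk_wittVector_eq_continuum [Countable k] [Nontrivial k] : #(WittVector p k) = 𝔠 := by
  rw [cardinalMk_wittVector, ← Cardinal.power_def, Cardinal.mk_nat]
  apply le_antisymm
  · calc #k ^ ℵ₀ ≤ ℵ₀ ^ ℵ₀ := power_le_power_right Cardinal.mk_le_aleph0
      _ = 𝔠 := Cardinal.aleph0_power_aleph0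
  · calc 𝔠 = 2 ^ ℵ₀ := Cardinal.two_power_aleph0.symm
      _ ≤ #k ^ ℵ₀ := power_le_power_right (Cardinal.two_le_iff.2 (exists_pair_ne k))

end Witt

section Field

variable (p : ℕ) [Fact p.Prime] (k : Type) [Field k] [Countable k]

/-- For a countable field `k`, the total ring of fractions `K = W(k)[1/p]` of `W(k)` has cardinality `𝔠`
(localisation at non-zero-divisors preserves cardinality). [folklore] -/
theorem cardinalMk_fractionRing_wittVector : #K(p, k) = 𝔠 := by
  rw [IsLocalization.cardinalMk K(p, k) (nonZeroDivisors (WittVector p k)) le_rfl,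
    cardinalMk_wittVector_eq_continuum]

variable [CharP k p]

/-- **`K = W(k)[1/p]` embeds into `ℂ`** for every countable field `k` of characteristic `p`: the
algebraic closure `K̄` is algebraically closed of characteristic `0` and cardinality `𝔠 = #ℂ`
(`#K ≤ #K̄ ≤ max #K ℵ₀`), hence ring-isomorphic to `ℂ` (Steinitz; Mathlib
`IsAlgClosed.ringEquiv_of_equiv_of_charZero`), and `K → K̄ ≅ ℂ`. [folklore] -/
theorem nonempty_ringHom_fractionRing_wittVector_complex : Nonempty (K(p, k) →+* ℂ) := by
  let Kb := AlgebraicClosure K(p, k)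
  haveI : CharZero K(p, k) :=
    charZero_of_injective_algebraMap (IsFractionRing.injective (WittVector p k) K(p, k))
  haveI : CharZero Kb := charZero_of_injective_algebraMap (algebraMap K(p, k) Kb).injective
  -- `#K̄ = 𝔠`
  have hle : #Kb ≤ 𝔠 := by
    refine (Algebra.IsAlgebraic.cardinalMk_le_max K(p, k) Kb).trans ?_
    rw [cardinalMk_fractionRing_wittVector, max_eq_left Cardinal.aleph0_le_continuum]
  have hge : 𝔠 ≤ #Kb := by
    rw [← cardinalMk_fractionRing_wittVector p k]
    exact Cardinal.mk_le_of_injective (algebraMap K(p, k) Kb).injective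
  have hKb : #Kb = 𝔠 := le_antisymm hle hge
  -- Steinitz: `K̄ ≅ ℂ`
  have hlt : ℵ₀ < #Kb := hKb ▸ Cardinal.aleph0_lt_continuum
  have heq : Nonempty (Kb ≃ ℂ) := Cardinal.eq.1 (hKb.trans Cardinal.mk_complex.symm)
  obtain ⟨e⟩ := IsAlgClosed.ringEquiv_of_equiv_of_charZero hlt heq
  exact ⟨e.toRingHom.comp (algebraMap K(p, k) Kb)⟩

end Field

/-- **`W(𝔽̄_p)[1/p]` embeds into `ℂ`** (`𝔽̄_p = AlgebraicClosure (ZMod p)` is countable: algebraic over the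
finite field `𝔽_p`). [folklore] -/
theorem nonempty_ringHom_fractionRing_wittVector_algebraicClosure_complex (p : ℕ) [Fact p.Prime] :
    Nonempty (K(p, AlgebraicClosure (ZMod p)) →+* ℂ) := by
  haveI : Countable (AlgebraicClosure (ZMod p)) := by
    rw [← Cardinal.mk_le_aleph0_iff]
    refine (Algebra.IsAlgebraic.cardinalMk_le_max (ZMod p) (AlgebraicClosure (ZMod p))).trans ?_
    exact max_le (Cardinal.mk_le_aleph0) le_rfl
  exact nonempty_ringHom_fractionRing_wittVector_complex p (AlgebraicClosure (ZMod p))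

end Summit.HodgeConjecture.HodgeConjecture.Theorems.AnchorsAtGenericHodgeLocusPoints

end
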